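import Literature.Probability.LatticeModels.TorusTwoPointLimit
import Literature.Probability.LatticeModels.ModifiedSimonInequality
import Literature.Probability.LatticeModels.SusceptibilityMeanFieldBound
import Literature.MathematicalPhysics.QuantumLattice.LatticeToriProofs
import HarnessLib

/-!
# Uniform exponential decay of the periodic two-point function from the modified Simon inequality

Topic `Literature/Probability/LatticeModels`; family `crit-ising`. Theorem-only file (no definition,
no named fact, no sorry). The torus sup-distance is the tree's `torusNorm` of
`Literature.MathematicalPhysics.QuantumLattice.LatticeTori` (a cubic torus is a `RectTorusSite` with
constant sides), whose cyclic coordinate `min(a, N - a)` is Mathlib's `ZMod.valMinAbs.natAbs`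
(`ZMod.valMinAbs_natAbs_eq_min`); only the comparison with the centred representatives of `ℤ^d`
(`torusNorm_proj_le`, `torusNorm_proj_eq`) is new here.

## What is proved

For the nearest-neighbour Ising model on the torus `(ℤ/Nℤ)^d` at `β ≥ 0`, zero field
(`isingTorusTwoPoint`), and Duminil-Copin–Tassion's functional `φ_β(Λ_R)` of the box
`Λ_R ⊂ ℤ^d` (`dctIsingPhi`, defined with the free state of the box):

* `isingTorusTwoPoint_le_dctIsingPhi_mul` — **the modified Simon inequality on the torus**, one
  step: for `2R + 4 ≤ N` and `u` at torus sup-distance `> R` from `0`,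
  `⟨σ₀σ_u⟩_{𝕋_N;β} ≤ ∑_{x ∈ Λ_R} ∑_{y ∼ x, y ∉ Λ_R} tanh β ⟨σ₀σ_x⟩^∅_{Λ_R;β} ⟨σ₀σ_{u-ȳ}⟩_{𝕋_N;β}`
  (Duminil-Copin–Tassion 2016, Lemma 2.7, whose random-current proof works on every finite graph —
  the tree's `isingTwoPoint_free_le_modifiedSimon` — applied to the torus with `S` the image of
  `Λ_R`, an isomorphic copy of the free box);
* `isingTorusTwoPoint_le_dctIsingPhi_pow` — **the iteration** (DCT 2016, §2.5):
  `⟨σ₀σ_u⟩_{𝕋_N;β} ≤ φ_β(Λ_R)^{⌊|u|_𝕋/(R+1)⌋}` for all `u`, uniformly in `N ≥ 2R + 4`, where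
  `|u|_𝕋 = maxᵢ min(uᵢ, N - uᵢ)` is the sup-distance on the torus (`torusNorm` of `LatticeTori`);
* `isingTorusTwoPoint_proj_le_dctIsingPhi_pow` — the same for `u = x̄`, `x ∈ ℤ^d` with `2‖x‖_∞ ≤ N`,
  with exponent `⌊‖x‖_∞/(R+1)⌋`;
* `exists_dctIsingPhi_box_lt_one_of_lt_criticalBeta` — for `d ≥ 2` and `0 ≤ β < β_c` there is a
  box with `φ_β(Λ_R) < 1` (DCT 2016, Thm 2.1 with `β̃_c = β_c`: finite susceptibility below `β_c`,
  the tree's `susceptibility_lt_top_of_lt_criticalBeta`, and `exists_dctIsingPhi_box_lt_one_of_bounded`),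
  so that the decay is exponential and **uniform in the size of the torus**
  (`exists_uniform_decay_isingTorusTwoPoint`) — the
  domination needed to pass Fourier transforms to the infinite-volume limit (Aizenman–Duminil-Copin
  2021, Prop. 5.2, third item, "the exponential decay of correlations, which at any `β < β_c(ρ)`
  are exponentially bounded, uniformly in the volume").

## References

* H. Duminil-Copin, V. Tassion, Comm. Math. Phys. 343 (2016) 725 = arXiv:1502.03050, Lemma 2.7 and
  §2.5 [DuminilCopinTassionCMP2016].
* M. Aizenman, H. Duminil-Copin, Ann. of Math. 194 (2021) = arXiv:1912.07973, Prop. 5.2 (p. 17)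
  [AizenmanDuminilCopinAnnals2021].

## Mathlib

`ZMod.val_intCast`, `Finset.sup`; no new Mathlib-level notion.
-/

noncomputable section

open MeasureTheory Filter Topology Finset

namespace Literature.Probability.LatticeModels

/-! ### Part 1. The sup-distance on the torus: the centred representatives of `ℤ^d` -/

section Norm

open Literature.MathematicalPhysics.QuantumLattice

variable {N : ℕ} [NeZero N]

/-- `|z mod N|_N ≤ |z|` for an integer `z`, for the cyclic absolute value `min(a, N - a)` of
`torusNorm` (`LatticeTori`; Mathlib's `ZMod.valMinAbs.natAbs`, `ZMod.valMinAbs_natAbs_eq_min`). [folklore] -/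
theorem cyclicAbs_intCast_le (z : ℤ) : min ((z : ZMod N).val) (N - (z : ZMod N).val) ≤ z.natAbs := by
  have hv : (((z : ZMod N).val : ℕ) : ℤ) = z % N := ZMod.val_intCast z
  have hlt := ZMod.val_lt (z : ZMod N)
  have hN : (0 : ℤ) < N := by exact_mod_cast Nat.pos_of_ne_zero (NeZero.ne N)
  have h1 : z % N = z - N * (z / N) := Int.emod_def z N
  have h2 := Int.emod_nonneg z hN.ne'
  have h3 := Int.emod_lt_of_pos z hN
  set v := (z : ZMod N).val with hvdef
  set q := z / N with hq
  rcases le_or_gt 0 z with hz | hz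
  · have hq0 : 0 ≤ q := Int.ediv_nonneg hz hN.le
    have hNq : 0 ≤ (N : ℤ) * q := mul_nonneg hN.le hq0
    have hzabs : (z.natAbs : ℤ) = z := Int.natAbs_of_nonneg hz
    have : (v : ℤ) ≤ z := by linarith
    omega
  · have hqneg : q < 0 := Int.ediv_neg_of_neg_of_pos hz hN
    have hq1 : q ≤ -1 := by omega
    have hNq : (N : ℤ) * q ≤ (N : ℤ) * (-1) := mul_le_mul_of_nonneg_left hq1 hN.le
    have hzabs : (z.natAbs : ℤ) = -z := Int.ofNat_natAbs_of_nonpos hz.le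
    have : ((N : ℤ) - v) ≤ -z := by linarith
    omega

/-- `|z mod N|_N = |z|` when `2|z| ≤ N` (the centred representative). [folklore] -/
theorem cyclicAbs_intCast_eq {z : ℤ} (hz2 : 2 * z.natAbs ≤ N) :
    min ((z : ZMod N).val) (N - (z : ZMod N).val) = z.natAbs := by
  have hv : (((z : ZMod N).val : ℕ) : ℤ) = z % N := ZMod.val_intCast z
  have hlt := ZMod.val_lt (z : ZMod N)
  have hN : (0 : ℤ) < N := by exact_mod_cast Nat.pos_of_ne_zero (NeZero.ne N)
  have h1 : z % N = z - N * (z / N) := Int.emod_def z N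
  have h2 := Int.emod_nonneg z hN.ne'
  have h3 := Int.emod_lt_of_pos z hN
  have hz2' : (2 : ℤ) * z.natAbs ≤ N := by exact_mod_cast hz2
  set v := (z : ZMod N).val with hvdef
  set q := z / N with hq
  rcases le_or_gt 0 z with hz | hz
  · have hzabs : (z.natAbs : ℤ) = z := Int.natAbs_of_nonneg hz
    have hq0 : q = 0 := Int.ediv_eq_zero_of_lt hz (by linarith)
    rw [hq0, mul_zero, sub_zero] at h1
    omega
  · have hzabs : (z.natAbs : ℤ) = -z := Int.ofNat_natAbs_of_nonpos hz.le
    have hqneg : q < 0 := Int.ediv_neg_of_neg_of_pos hz hN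
    rcases eq_or_ne (z % N) 0 with h0 | h0
    · exfalso
      have hq1 : q ≤ -1 := by omega
      have hNq : (N : ℤ) * q ≤ (N : ℤ) * (-1) := mul_le_mul_of_nonneg_left hq1 hN.le
      have : z ≤ -N := by linarith
      linarith
    · have hq1 : q = -1 := by
        have : -1 ≤ q := by
          by_contra hcon
          push Not at hcon
          have hq2 : q ≤ -2 := by omega
          have hNq : (N : ℤ) * q ≤ (N : ℤ) * (-2) := mul_le_mul_of_nonneg_left hq2 hN.le
          have : z < -N := by linarith
          linarith
        omega
      rw [hq1] at h1
      omega

variable {d : ℕ}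

omit [NeZero N] in
/-- Each cyclic coordinate is bounded by the torus sup-norm `torusNorm` of `LatticeTori`
(on the cubic torus `(ℤ/Nℤ)^d`, a `RectTorusSite` with constant sides, `rectTorusSite_const`). [folklore] -/
theorem cyclicAbs_le_torusNorm (u : TorusSite d N) (i : Fin d) :
    min (u i).val (N - (u i).val) ≤ torusNorm (Ls := fun _ => N) u :=
  Finset.le_sup (f := fun i => min (u i).val (N - (u i).val)) (Finset.mem_univ i)

/-- `|u - v|_𝕋 ≥ |u|_𝕋 - |v|_𝕋` (from `torusNorm_add_le`). [folklore] -/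
theorem torusNorm_le_torusNorm_sub_add (u v : TorusSite d N) :
    torusNorm (Ls := fun _ => N) u ≤ torusNorm (Ls := fun _ => N) (u - v) + torusNorm (Ls := fun _ => N) v := by
  have := torusNorm_add_le (Ls := fun _ => N) (u - v) v
  rwa [sub_add_cancel] at this

/-- `|x̄|_𝕋 ≤ ‖x‖_∞` for `x ∈ ℤ^d`. [folklore] -/
theorem torusNorm_proj_le (x : Site d) : torusNorm (Ls := fun _ => N) (Torus.proj N x) ≤ Site.supNorm x := by
  refine Finset.sup_le fun i _ => ?_
  change min (Torus.proj N x i).val (N - (Torus.proj N x i).val) ≤ _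
  rw [Torus.proj_apply]
  exact (cyclicAbs_intCast_le (x i)).trans (Site.natAbs_le_supNorm x i)

/-- `|x̄|_𝕋 = ‖x‖_∞` for `x ∈ ℤ^d` with `2‖x‖_∞ ≤ N` (the centred representative). [folklore] -/
theorem torusNorm_proj_eq {x : Site d} (hx : 2 * Site.supNorm x ≤ N) :
    torusNorm (Ls := fun _ => N) (Torus.proj N x) = Site.supNorm x := by
  refine le_antisymm (torusNorm_proj_le x) ?_
  unfold Site.supNorm
  refine Finset.sup_le fun i _ => ?_
  have hi : 2 * (x i).natAbs ≤ N := le_trans (Nat.mul_le_mul_left 2 (Site.natAbs_le_supNorm x i)) hx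
  rw [← cyclicAbs_intCast_eq hi, ← Torus.proj_apply N x i]
  exact cyclicAbs_le_torusNorm _ i

end Norm

/-! ### Part 2. The modified Simon inequality on the torus and its iteration -/

section Decay

open Literature.MathematicalPhysics.QuantumLattice

variable {d N : ℕ} [NeZero N]

/-- **The free box inside the torus is the free box**: for `x, y ∈ Λ_M` and `2M + 1 < N`,
`⟨σ_{x̄}σ_{ȳ}⟩^∅_{Λ̄_M;β} = ⟨σ_xσ_y⟩^∅_{Λ_M;β}` (the image `Λ̄_M` of the box in `(ℤ/Nℤ)^d` induces an
isomorphic graph; `isingTwoPoint_free_map` twice, through the box as a vertex type — the argument of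
`isingTwoPoint_free_box_le_torus_of_gks`). [cite: FriedliVelenik2017, §3.1, Def. 3.1] -/
theorem isingTwoPoint_torus_image_box_eq {β : ℝ} (h : ℝ) {M : ℕ} (hMN : 2 * M + 1 < N) {x y : Site d}
    (hx : x ∈ box d M) (hy : y ∈ box d M) :
    isingTwoPoint (torusGraph d N) ((box d M).image (Torus.proj N)) β h .free (Torus.proj N x) (Torus.proj N y) =
      isingTwoPoint (zdGraph d) (box d M) β h .free x y := by
  classical
  set S := ↥(box d M) with hS
  let ι₁ : S ↪ Site d := Function.Embedding.subtype _
  let Gs : SimpleGraph S := (zdGraph d).comap ι₁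
  have h1 : isingTwoPoint (zdGraph d) (box d M) β h .free x y =
      isingTwoPoint Gs Finset.univ β h .free ⟨x, hx⟩ ⟨y, hy⟩ := by
    have hmap : (Finset.univ : Finset S).map ι₁ = box d M := by
      rw [Finset.univ_eq_attach, Finset.attach_map_val]
    have := isingTwoPoint_free_map (G := Gs) (G' := zdGraph d) ι₁ (Λ := Finset.univ)
      (fun a _ b _ => Iff.rfl) β h ⟨x, hx⟩ ⟨y, hy⟩
    rw [hmap] at this
    exact this
  let ι₂ : S ↪ TorusSite d N :=
    ⟨fun a => Torus.proj N a.1, fun a b hab =>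
      Subtype.ext (torusProj_injOn_box (by omega) a.2 b.2 hab)⟩
  have hadj : ∀ a ∈ (Finset.univ : Finset S), ∀ b ∈ (Finset.univ : Finset S),
      ((torusGraph d N).Adj (ι₂ a) (ι₂ b) ↔ Gs.Adj a b) := fun a _ b _ =>
    torusGraph_adj_proj_iff hMN a.2 b.2
  have hmap₂ : (Finset.univ : Finset S).map ι₂ = (box d M).image (Torus.proj N) := by
    ext u
    simp only [Finset.mem_map, Finset.mem_univ, true_and, Finset.mem_image]
    constructor
    · rintro ⟨a, rfl⟩; exact ⟨a.1, a.2, rfl⟩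
    · rintro ⟨z, hz, rfl⟩; exact ⟨⟨z, hz⟩, rfl⟩
  have h2 : isingTwoPoint Gs Finset.univ β h .free ⟨x, hx⟩ ⟨y, hy⟩ =
      isingTwoPoint (torusGraph d N) (Finset.univ.map ι₂) β h .free (Torus.proj N x) (Torus.proj N y) :=
    (isingTwoPoint_free_map (G := Gs) (G' := torusGraph d N) ι₂ hadj β h ⟨x, hx⟩ ⟨y, hy⟩).symm
  rw [h1, h2, hmap₂]

/-- Translation invariance in the form `⟨σ_vσ_u⟩_{𝕋_N} = ⟨σ₀σ_{u-v}⟩_{𝕋_N}`. [cite: FriedliVelenik2017, §10.5.2] -/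
theorem isingTorusTwoPoint_eq_zero_sub (β h : ℝ) (v u : TorusSite d N) :
    isingTorusTwoPoint d N β h v u = isingTorusTwoPoint d N β h 0 (u - v) := by
  rw [isingTorusTwoPoint_eq_torusTwoPoint, isingTorusTwoPoint_eq_torusTwoPoint, sub_zero]

/-- `0 ≤ ⟨σ_uσ_v⟩_{𝕋_N;β}` for `β ≥ 0` (GKS I). [cite: FriedliVelenik2017, Thm. 3.20] -/
theorem isingTorusTwoPoint_nonneg {β : ℝ} (hβ : 0 ≤ β) (u v : TorusSite d N) :
    0 ≤ isingTorusTwoPoint d N β 0 u v := by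
  rcases eq_or_ne u v with rfl | huv
  · simp [isingTorusTwoPoint]
  · rw [isingTorusTwoPoint, isingTwoPoint_eq_isingCorr _ _ _ _ _ huv]
    exact GriffithsKellySherman.gks_one_holds (torusGraph d N) hβ le_rfl (Or.inl rfl) (Finset.subset_univ _)

/-- `⟨σ_uσ_v⟩_{𝕋_N;β} ≤ 1`. [folklore] -/
theorem isingTorusTwoPoint_le_one (β h : ℝ) (u v : TorusSite d N) : isingTorusTwoPoint d N β h u v ≤ 1 :=
  (le_abs_self _).trans (abs_isingTwoPoint_le_one _ _ _ _ _ _ _)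

/-- Points of the image of the box are within torus distance `R`. [folklore] -/
theorem torusNorm_le_of_mem_image_box {R : ℕ} {u : TorusSite d N} (hu : u ∈ (box d R).image (Torus.proj N)) :
    torusNorm (Ls := fun _ => N) u ≤ R := by
  obtain ⟨y, hy, rfl⟩ := Finset.mem_image.1 hu
  refine (torusNorm_proj_le y).trans ?_
  rw [mem_box] at hy
  unfold Site.supNorm
  refine Finset.sup_le fun i _ => ?_
  have := hy i
  omega

/-- **The modified Simon inequality on the torus** (Duminil-Copin–Tassion 2016, Lemma 2.7 — a
random-current inequality valid on every finite graph, `isingTwoPoint_free_le_modifiedSimon` —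
applied to `(ℤ/Nℤ)^d` with `S = Λ̄_R` the image of the box, which for `2R + 4 ≤ N` is an isomorphic
copy of the free box with the same outer neighbours): for `β ≥ 0` and `u` at torus distance `> R`,
`⟨σ₀σ_u⟩_{𝕋_N;β} ≤ ∑_{x ∈ Λ_R} ∑_{y ∼ x, y ∉ Λ_R} tanh β · ⟨σ₀σ_x⟩^∅_{Λ_R;β} · ⟨σ₀σ_{u - ȳ}⟩_{𝕋_N;β}`.
[cite: DuminilCopinTassionCMP2016, Lemma 2.7 (modified Simon inequality), §2.5 (arXiv:1502.03050 numbering)] -/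
theorem isingTorusTwoPoint_le_modifiedSimon {β : ℝ} (hβ : 0 ≤ β) {R : ℕ} (hRN : 2 * R + 4 ≤ N)
    {u : TorusSite d N} (hu : R < torusNorm (Ls := fun _ => N) u) :
    isingTorusTwoPoint d N β 0 0 u ≤
      ∑ x ∈ box d R, ∑ y ∈ ((zdGraph d).neighborFinset x).filter (fun y => y ∉ box d R),
        Real.tanh β * isingTwoPoint (zdGraph d) (box d R) β 0 .free 0 x *
          isingTorusTwoPoint d N β 0 0 (u - Torus.proj N y) := by
  classical
  set S : Finset (TorusSite d N) := (box d R).image (Torus.proj N) with hS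
  have h0S : (0 : TorusSite d N) ∈ S := Finset.mem_image.2 ⟨0, by simp [mem_box], by funext i; simp⟩
  have huS : u ∉ S := fun huS => absurd (torusNorm_le_of_mem_image_box huS) (not_le.2 hu)
  have key := isingTwoPoint_free_le_modifiedSimon (torusGraph d N) hβ (Finset.subset_univ S) h0S
    (Finset.mem_univ u) huS
  rw [isingTorusTwoPoint]
  refine key.trans (le_of_eq ?_)
  -- reindex `x̄ = proj x`, `ȳ = proj y`
  have hinjR : Set.InjOn (Torus.proj N) (box d R : Set (Site d)) := fun a ha b hb hab =>
    torusProj_injOn_box (by omega) ha hb hab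
  rw [hS, Finset.sum_image hinjR]
  refine Finset.sum_congr rfl fun x hx => ?_
  -- the outer neighbours of `x̄` in the torus are the images of the outer neighbours of `x`
  have hinj1 : Set.InjOn (Torus.proj N) (((zdGraph d).neighborFinset x).filter (fun y => y ∉ box d R) : Set (Site d)) := by
    intro a ha b hb hab
    have ha' : a ∈ box d (R + 1) := mem_box_succ_of_zdGraph_adj (d := d) hx (by simpa using (Finset.mem_filter.1 ha).1)
    have hb' : b ∈ box d (R + 1) := mem_box_succ_of_zdGraph_adj (d := d) hx (by simpa using (Finset.mem_filter.1 hb).1)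
    exact torusProj_injOn_box (by omega) ha' hb' hab
  have hset : (Finset.univ \ (box d R).image (Torus.proj N)).filter ((torusGraph d N).Adj (Torus.proj N x)) =
      (((zdGraph d).neighborFinset x).filter (fun y => y ∉ box d R)).image (Torus.proj N) := by
    ext w
    simp only [Finset.mem_filter, Finset.mem_sdiff, Finset.mem_univ, true_and, Finset.mem_image,
      SimpleGraph.mem_neighborFinset]
    constructor
    · rintro ⟨hw, hadj⟩
      obtain ⟨-, y, rfl, hxy⟩ := (torusGraph_adj_proj_left_iff N x w).1 hadj
      refine ⟨y, ⟨hxy, fun hyR => hw ⟨y, hyR, rfl⟩⟩, rfl⟩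
    · rintro ⟨y, ⟨hxy, hyR⟩, rfl⟩
      have hy' : y ∈ box d (R + 1) := mem_box_succ_of_zdGraph_adj (d := d) hx hxy
      refine ⟨?_, ?_⟩
      · rintro ⟨y₀, hy₀, heq⟩
        have := torusProj_injOn_box (M := R + 1) (by omega) (box_mono d (Nat.le_succ R) hy₀) hy' heq
        subst this
        exact hyR hy₀
      · exact (torusGraph_adj_proj_iff (M := R + 1) (by omega) (box_mono d (Nat.le_succ R) hx) hy').2 hxy
  rw [hset, Finset.sum_image hinj1]
  refine Finset.sum_congr rfl fun y _ => ?_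
  have h0 : (0 : Site d) ∈ box d R := by simp [mem_box]
  rw [show (0 : TorusSite d N) = Torus.proj N 0 from (by funext i; simp),
    isingTwoPoint_torus_image_box_eq 0 (by omega) h0 hx]
  congr 1
  rw [show Torus.proj N (0 : Site d) = 0 from (by funext i; simp), ← isingTorusTwoPoint,
    isingTorusTwoPoint_eq_zero_sub]

/-- **The iteration** (Duminil-Copin–Tassion 2016, §2.5: "`⟨σ₀σ_z⟩ ≤ φ_β(S) max_{y ∈ Λ_L}⟨σ_yσ_z⟩` …
iterating `⌊n/L⌋` times"), on the torus with the torus sup-distance: for `β ≥ 0`, `2R + 4 ≤ N`,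
every `k` and every `u` with `k(R+1) ≤ |u|_𝕋`, `⟨σ₀σ_u⟩_{𝕋_N;β} ≤ φ_β(Λ_R)^k`.
[cite: DuminilCopinTassionCMP2016, §2.5, end of the proof of Thm. 2.1 (iteration)] -/
theorem isingTorusTwoPoint_le_dctIsingPhi_pow_of_le {β : ℝ} (hβ : 0 ≤ β) {R : ℕ} (hRN : 2 * R + 4 ≤ N) :
    ∀ (k : ℕ) (u : TorusSite d N), k * (R + 1) ≤ torusNorm (Ls := fun _ => N) u →
      isingTorusTwoPoint d N β 0 0 u ≤ dctIsingPhi d β (box d R) ^ k := by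
  intro k
  induction k with
  | zero =>
    intro u _
    rw [pow_zero]
    exact isingTorusTwoPoint_le_one β 0 0 u
  | succ k ih =>
    intro u hu
    have hR : R < torusNorm (Ls := fun _ => N) u := by
      have : (k + 1) * (R + 1) = k * (R + 1) + (R + 1) := by ring
      omega
    refine (isingTorusTwoPoint_le_modifiedSimon hβ hRN hR).trans ?_
    have h0 : (0 : Site d) ∈ box d R := by simp [mem_box]
    have hbound : ∀ x ∈ box d R, ∀ y ∈ ((zdGraph d).neighborFinset x).filter (fun y => y ∉ box d R),
        Real.tanh β * isingTwoPoint (zdGraph d) (box d R) β 0 .free 0 x *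
            isingTorusTwoPoint d N β 0 0 (u - Torus.proj N y) ≤
          Real.tanh β * isingTwoPoint (zdGraph d) (box d R) β 0 .free 0 x * dctIsingPhi d β (box d R) ^ k := by
      intro x hx y hy
      refine mul_le_mul_of_nonneg_left ?_
        (mul_nonneg (tanh_nonneg hβ) (isingTwoPoint_free_nonneg
          (fun {_ _ _ _ _} => GriffithsKellySherman.gks_one_holds (zdGraph d)) hβ h0 hx))
      refine ih (u - Torus.proj N y) ?_
      have hyx : (zdGraph d).Adj x y := by simpa using (Finset.mem_filter.1 hy).1
      have hy1 : Site.supNorm y ≤ R + 1 := by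
        have := mem_box_succ_of_zdGraph_adj (d := d) hx hyx
        rw [mem_box] at this
        unfold Site.supNorm
        refine Finset.sup_le fun i _ => ?_
        have := this i
        omega
      have htri := torusNorm_le_torusNorm_sub_add u (Torus.proj N y)
      have hproj : torusNorm (Ls := fun _ => N) (Torus.proj N y) ≤ R + 1 := (torusNorm_proj_le y).trans hy1
      have : (k + 1) * (R + 1) = k * (R + 1) + (R + 1) := by ring
      omega
    calc ∑ x ∈ box d R, ∑ y ∈ ((zdGraph d).neighborFinset x).filter (fun y => y ∉ box d R),
          Real.tanh β * isingTwoPoint (zdGraph d) (box d R) β 0 .free 0 x *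
            isingTorusTwoPoint d N β 0 0 (u - Torus.proj N y)
        ≤ ∑ x ∈ box d R, ∑ y ∈ ((zdGraph d).neighborFinset x).filter (fun y => y ∉ box d R),
          Real.tanh β * isingTwoPoint (zdGraph d) (box d R) β 0 .free 0 x * dctIsingPhi d β (box d R) ^ k :=
          Finset.sum_le_sum fun x hx => Finset.sum_le_sum fun y hy => hbound x hx y hy
      _ = (∑ x ∈ box d R, ∑ _y ∈ ((zdGraph d).neighborFinset x).filter (fun y => y ∉ box d R),
            Real.tanh β * isingTwoPoint (zdGraph d) (box d R) β 0 .free 0 x) * dctIsingPhi d β (box d R) ^ k := by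
          simp_rw [Finset.sum_mul]
      _ = dctIsingPhi d β (box d R) ^ (k + 1) := by
          rw [pow_succ', dctIsingPhi_def]

/-- **Uniform decay of the periodic two-point function** (Duminil-Copin–Tassion 2016, Thm 2.1 (3) via
Lemma 2.7 and §2.5, on the torus): for `β ≥ 0` and `2R + 4 ≤ N`,
`⟨σ₀σ_u⟩_{𝕋_N;β} ≤ φ_β(Λ_R)^{⌊|u|_𝕋/(R+1)⌋}` for every `u ∈ (ℤ/Nℤ)^d` — a bound **uniform in `N`**.
[cite: DuminilCopinTassionCMP2016, Thm. 2.1 (3) with Lemma 2.7, §2.5] -/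
theorem isingTorusTwoPoint_le_dctIsingPhi_pow {β : ℝ} (hβ : 0 ≤ β) {R : ℕ} (hRN : 2 * R + 4 ≤ N)
    (u : TorusSite d N) :
    isingTorusTwoPoint d N β 0 0 u ≤ dctIsingPhi d β (box d R) ^ (torusNorm (Ls := fun _ => N) u / (R + 1)) :=
  isingTorusTwoPoint_le_dctIsingPhi_pow_of_le hβ hRN _ u (Nat.div_mul_le_self _ _)

/-- The same for the image of `x ∈ ℤ^d` with `2‖x‖_∞ ≤ N` (the centred representatives of the torus):
`⟨σ₀σ_{x̄}⟩_{𝕋_N;β} ≤ φ_β(Λ_R)^{⌊‖x‖_∞/(R+1)⌋}`. [cite: DuminilCopinTassionCMP2016, Thm. 2.1 (3) with Lemma 2.7, §2.5] -/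
theorem isingTorusTwoPoint_proj_le_dctIsingPhi_pow {β : ℝ} (hβ : 0 ≤ β) {R : ℕ} (hRN : 2 * R + 4 ≤ N)
    {x : Site d} (hx : 2 * Site.supNorm x ≤ N) :
    isingTorusTwoPoint d N β 0 0 (Torus.proj N x) ≤ dctIsingPhi d β (box d R) ^ (Site.supNorm x / (R + 1)) := by
  rw [← torusNorm_proj_eq hx]
  exact isingTorusTwoPoint_le_dctIsingPhi_pow hβ hRN _

end Decay

/-! ### Part 3. A box with `φ_β(Λ_R) < 1` below `β_c` -/

section Subcritical

variable {d : ℕ}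

/-- **For `d ≥ 2` and `0 ≤ β < β_c` some box has `φ_β(Λ_R) < 1`, `R ≥ 1`** (Duminil-Copin–Tassion
2016, Thm 2.1 / §2.1, "`χ(β) < ∞ ⇒ β ≤ β̃_c`": from the finiteness of the susceptibility below `β_c`
— the tree's `susceptibility_lt_top_of_lt_criticalBeta`, i.e. exponential decay by sharpness — the
bounded box sums force `φ_β(Λ_n) → 0`, `exists_dctIsingPhi_box_lt_one_of_bounded`). Combined with
`isingTorusTwoPoint_le_dctIsingPhi_pow` this is the exponential decay of the periodic two-point
function **uniformly in the torus**, at every `β < β_c`. [cite: DuminilCopinTassionCMP2016, Thm. 2.1 and §2.1 (β̃_c = β_c)] -/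
theorem exists_dctIsingPhi_box_lt_one_of_lt_criticalBeta (hd : 2 ≤ d) {β : ℝ} (hβ : 0 ≤ β)
    (hβc : β < criticalBeta d) :
    ∃ R : ℕ, 1 ≤ R ∧ dctIsingPhi d β (box d R) < 1 := by
  have hχ := susceptibility_lt_top_of_lt_criticalBeta hd hβ hβc
  set M : ℝ := (susceptibility d β).toReal with hM
  have hχM : susceptibility d β ≤ ENNReal.ofReal M := by
    rw [hM, ENNReal.ofReal_toReal hχ.ne]
  exact exists_dctIsingPhi_box_lt_one_of_bounded hβ
    (fun L => volumeSusceptibility_box_le_of_susceptibility_le hβ ENNReal.toReal_nonneg hχM L)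

/-- **Uniform exponential decay of the periodic two-point function below `β_c`**, packaged: for
`d ≥ 2` and `0 ≤ β < β_c` there are `R ≥ 1` and `θ ∈ [0, 1)` such that for every torus
`(ℤ/Nℤ)^d` with `N ≥ 2R + 4` and every `x ∈ ℤ^d` with `2‖x‖_∞ ≤ N`,
`0 ≤ ⟨σ₀σ_{x̄}⟩_{𝕋_N;β} ≤ θ^{⌊‖x‖_∞/(R+1)⌋}` (Aizenman–Duminil-Copin 2021, Prop. 5.2, the ingredient
"exponential decay of correlations … uniformly in the volume"). [cite: AizenmanDuminilCopinAnnals2021, arXiv:1912.07973 Prop. 5.2 (p. 17)] [cite: DuminilCopinTassionCMP2016, Thm. 2.1 (3), Lemma 2.7, §2.5] -/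
theorem exists_uniform_decay_isingTorusTwoPoint (hd : 2 ≤ d) {β : ℝ} (hβ : 0 ≤ β) (hβc : β < criticalBeta d) :
    ∃ (R : ℕ) (θ : ℝ), 1 ≤ R ∧ 0 ≤ θ ∧ θ < 1 ∧
      ∀ (N : ℕ) [NeZero N], 2 * R + 4 ≤ N → ∀ x : Site d, 2 * Site.supNorm x ≤ N →
        0 ≤ isingTorusTwoPoint d N β 0 0 (Torus.proj N x) ∧
          isingTorusTwoPoint d N β 0 0 (Torus.proj N x) ≤ θ ^ (Site.supNorm x / (R + 1)) := by
  obtain ⟨R, hR1, hφ⟩ := exists_dctIsingPhi_box_lt_one_of_lt_criticalBeta hd hβ hβc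
  refine ⟨R, dctIsingPhi d β (box d R), hR1,
    dctIsingPhi_nonneg (fun {_ _ _ _ _} => GriffithsKellySherman.gks_one_holds (zdGraph d)) hβ (zero_mem_box d R),
    hφ, fun N _ hN x hx => ⟨isingTorusTwoPoint_nonneg hβ _ _, isingTorusTwoPoint_proj_le_dctIsingPhi_pow hβ hN hx⟩⟩

end Subcritical

end Literature.Probability.LatticeModels

end
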